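import Summits.CriticalPhenomena.PercolationContinuityZ3.Theorems.PercFiniteBoxLRORenormaliseFromLinearLRODefs
import Literature.Probability.Percolation.SharpnessDCTProofs

/-!
# `stub_coarseGlue` of line `registered` (crux `PercFiniteBoxLRO.RenormaliseFromLinearLRO`,
# stmt-CriticalPhenomena-0857): an infinite coarse cluster of good blocks carries an infinite open
# cluster meeting `B(n)`

Registered stub `stub_coarseGlue` of the lead's skeleton: the deterministic pull-back of the planar
coarse-graining (blocks `a ∈ ℤ²` ↦ boxes `B_a = blockCentre n a + B(n)` of `ℤ³`, objects file
`PercFiniteBoxLRORenormaliseFromLinearLRODefs.lean`).  If the cluster of `0` in the coarse good-edge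
configuration `coarseCfg n ω` is infinite (and `ω` is a lattice configuration, `n ≥ 1`), then some
vertex of `B(n) = B_0` has an infinite open cluster in `ω` (Grimmett 1999, §7.4 p.178, Fig. 7.13).

Proof.
* Transport (`pathIn_shift_of_mem_openConnIn`, `mem_openConnIn_shift_of_pathIn`): the block event
  at `a` is `G_n` for the configuration shifted by `c = blockCentre n a`; open paths inside `B(n)`
  of the shifted configuration are the open paths of `ω` inside `c + B(n)`, translated by `c`.
* Gluing of good neighbours (`reachable_of_crossings`): for `c' = c + n e_j`, the crossing vertex
  of the block at `c'` is joined inside `B_{c'}` to the faces `z_j = c_j` and `z_j = c_j + 2n`;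
  following this open path from the face `z_j = c_j` up to its FIRST vertex at level `c_j + n`
  (lattice steps move coordinate `j` by at most one, `PathIn.exit`) gives an open path inside
  `B_c ∩ B_{c'}` of
  `j`-spread exactly `n`; in-box uniqueness (clause (b) of `G_n` at `c`) joins it to the crossing
  vertex of `B_c`, whose spread is `2n`.  Hence the two crossing vertices are joined in `ω`.
* Induction along coarse open paths (`reachable_crossing_of_coarse`): every coarse-open edge is
  `{b, b + e_i}` with both blocks good, so one crossing vertex `X b` chosen per good block is joined
  to `X 0` for every `b` in the coarse cluster of `0`.
* Finite-to-one (`stub_coarseGlue`): `X b ∈ B_b` pins `b` up to finitely many choices given `X b`,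
  so an infinite coarse cluster yields an unbounded, hence infinite, open cluster of `X 0 ∈ B(n)`
  (adapted from `exists_infinite_openCluster_of_coarse`, SlabCriticalityInputs.lean).

References: G. Grimmett, *Percolation*, 2nd ed. (1999), §7.4 pp.177–181 (static renormalisation,
Fig. 7.13); H. Duminil-Copin, V. Sidoravicius, V. Tassion, CPAM 69 (2016) §2.2.  Pure theorem file.
-/

namespace Summit.CriticalPhenomena.PercolationContinuityZ3.Theorems.RenormaliseFromLinearLRO

open Literature.Probability.Percolation Literature.Probability.LatticeModels
open MeasureTheory

/-! ## Block centres -/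

/-- The block of the origin is centred at the origin: `blockCentre n 0 = 0`. -/
theorem blockCentre_zero (n : ℕ) : blockCentre n (0 : Site 2) = 0 := by
  ext k
  fin_cases k <;> simp [blockCentre]

/-- Centres of neighbouring blocks differ by `n eⱼ`:
`blockCentre n (a + eⱼ) = blockCentre n a + n e_{j}` (with `j : Fin 2 ↪ Fin 3`). -/
theorem blockCentre_add_single (n : ℕ) (a : Site 2) (j : Fin 2) :
    blockCentre n (a + Pi.single j 1) = blockCentre n a + Pi.single (Fin.castSucc j) (n : ℤ) := by
  ext k
  fin_cases j <;> fin_cases k <;> simp [blockCentre, mul_add]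

/-- Coordinates of the centre of a neighbouring block. -/
theorem blockCentre_add_single_apply (n : ℕ) (a : Site 2) (j : Fin 2) (k : Fin 3) :
    blockCentre n (a + Pi.single j 1) k =
      blockCentre n a k + if k = Fin.castSucc j then (n : ℤ) else 0 := by
  rw [blockCentre_add_single, Pi.add_apply, Pi.single_apply]

/-! ## Lattice steps and boxes -/

/-- A nearest-neighbour step of `ℤ^d` raises each coordinate by at most one. -/
theorem apply_le_apply_add_one_of_adj {d : ℕ} {p q : Site d} (h : (zdGraph d).Adj p q)
    (k : Fin d) : q k ≤ p k + 1 := by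
  obtain ⟨i, rfl | rfl⟩ := (zdGraph_adj_iff p q).1 h <;>
    simp only [Pi.add_apply, Pi.single_apply] <;> split_ifs <;> omega

/-- Overlap of neighbouring boxes: if `c'` is `c` moved by `n` in coordinate `j`, a point of
`c' + B(n)` at level `≤ c j + n` in coordinate `j` lies in `c + B(n)`. -/
theorem sub_mem_box_of_level {n : ℕ} {c c' z : Site 3} {j : Fin 3} (hcj : c' j = c j + n)
    (hck : ∀ k, k ≠ j → c' k = c k) (hz : z - c' ∈ (↑(box 3 n) : Set (Site 3)))
    (hzj : z j ≤ c j + n) : z - c ∈ (↑(box 3 n) : Set (Site 3)) := by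
  rw [Finset.mem_coe, mem_box] at hz ⊢
  intro k
  have hk := hz k
  simp only [Pi.sub_apply] at hk ⊢
  by_cases hkj : k = j
  · subst hkj; omega
  · rw [hck k hkj] at hk; exact hk

/-! ## Transport of in-box connections through the shift of configurations -/

/-- The open graph of the configuration shifted by `-c` (`s(x, y) ∈ · ↔ s(x + c, y + c) ∈ ω`):
`a ∼ b` iff `a + c ∼ b + c` is open in `ω`. -/
theorem openGraph_shiftCfg_adj (c : Site 3) (ω : BondConfig (Site 3)) (a b : Site 3) :
    (openGraph (BondConfig.relabel (sym2Equiv (Site.shift (-c))) ω)).Adj a b ↔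
      (openGraph ω).Adj (a + c) (b + c) := by
  have h := mk_add_mem_relabel_shift_iff (-c) ω (a + c) (b + c)
  simp only [add_neg_cancel_right] at h
  rw [openGraph_adj, openGraph_adj, h, (add_left_injective c).ne_iff]

/-- Local to global: an open path inside `S` of the configuration shifted by `-c` is an open path of
`ω` inside `c + S`, translated by `c`. -/
theorem pathIn_shift_of_mem_openConnIn {c : Site 3} {ω : BondConfig (Site 3)} {S : Set (Site 3)}
    {x y : Site 3} (h : BondConfig.relabel (sym2Equiv (Site.shift (-c))) ω ∈ openConnIn S x y) :
    PathIn (openGraph ω) {z : Site 3 | z - c ∈ S} (x + c) (y + c) :=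
  DCT16.pathIn_map (· + c) (fun a ha => by simpa using ha)
    (fun a b _ _ hab => (openGraph_shiftCfg_adj c ω a b).1 hab) (DCT16.pathIn_of_mem_openConnIn h)

/-- Global to local: an open path of `ω` inside `c + S` is, translated by `-c`, an in-`S` connection
of the configuration shifted by `-c`. -/
theorem mem_openConnIn_shift_of_pathIn {c : Site 3} {ω : BondConfig (Site 3)} {S : Set (Site 3)}
    {x y : Site 3} (h : PathIn (openGraph ω) {z : Site 3 | z - c ∈ S} x y) :
    BondConfig.relabel (sym2Equiv (Site.shift (-c))) ω ∈ openConnIn S (x - c) (y - c) :=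
  DCT16.mem_openConnIn_of_pathIn
    (DCT16.pathIn_map (· - c) (fun _ ha => ha)
      (fun a b _ _ hab => (openGraph_shiftCfg_adj c ω (a - c) (b - c)).2 (by simpa using hab)) h)

/-! ## Gluing of good neighbours (Grimmett 1999, §7.4 p.178, Fig. 7.13) -/

/-- **Gluing of good neighbouring boxes.**  Let `c' = c + n e_j` (`hcj`, `hck`), let the
configuration shifted by `-c` satisfy in-box uniqueness for vertices of spread `≥ n` (clause (b) of
`G_n`, `hb`), let `x` be joined inside `B(n)` (shifted by `-c`) to both `j`-faces (`hx`) and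
`x'` inside `B(n)` (shifted by `-c'`) to both `j`-faces (`hx'`).  Then `x + c` and `x' + c'` are
joined by an open path of `ω`: the face-to-face path of the block at `c'`, stopped at its first
passage of the level `c j + n`, is an open path inside both boxes of `j`-spread `n` starting on
the face `z j = c j`, and uniqueness inside `c + B(n)` joins it to `x + c`. -/
theorem reachable_of_crossings {n : ℕ} (hn : 1 ≤ n) {ω : BondConfig (Site 3)}
    (hω : ω ⊆ (zdGraph 3).edgeSet) {c c' : Site 3} {j : Fin 3} (hcj : c' j = c j + n)
    (hck : ∀ k, k ≠ j → c' k = c k) {x x' : Site 3}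
    (hb : ∀ y z : Site 3,
      (∃ u v : Site 3,
        BondConfig.relabel (sym2Equiv (Site.shift (-c))) ω ∈ openConnIn ↑(box 3 n) y u ∧
        BondConfig.relabel (sym2Equiv (Site.shift (-c))) ω ∈ openConnIn ↑(box 3 n) y v ∧
        ∃ i, (n : ℤ) ≤ |u i - v i|) →
      (∃ u v : Site 3,
        BondConfig.relabel (sym2Equiv (Site.shift (-c))) ω ∈ openConnIn ↑(box 3 n) z u ∧
        BondConfig.relabel (sym2Equiv (Site.shift (-c))) ω ∈ openConnIn ↑(box 3 n) z v ∧
        ∃ i, (n : ℤ) ≤ |u i - v i|) →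
      BondConfig.relabel (sym2Equiv (Site.shift (-c))) ω ∈ openConnIn ↑(box 3 n) y z)
    (hx : (∃ u : Site 3, u j = -(n : ℤ) ∧
        BondConfig.relabel (sym2Equiv (Site.shift (-c))) ω ∈ openConnIn ↑(box 3 n) x u) ∧
      (∃ v : Site 3, v j = (n : ℤ) ∧
        BondConfig.relabel (sym2Equiv (Site.shift (-c))) ω ∈ openConnIn ↑(box 3 n) x v))
    (hx' : (∃ u : Site 3, u j = -(n : ℤ) ∧
        BondConfig.relabel (sym2Equiv (Site.shift (-c'))) ω ∈ openConnIn ↑(box 3 n) x' u) ∧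
      (∃ v : Site 3, v j = (n : ℤ) ∧
        BondConfig.relabel (sym2Equiv (Site.shift (-c'))) ω ∈ openConnIn ↑(box 3 n) x' v)) :
    (openGraph ω).Reachable (x + c) (x' + c') := by
  obtain ⟨⟨u', hu'j, hxu'⟩, ⟨v', hv'j, hxv'⟩⟩ := hx'
  have hn' : (1 : ℤ) ≤ n := by exact_mod_cast hn
  -- the crossing vertex of the block at `c'` is joined inside that block to both `j`-faces
  have P1 := pathIn_shift_of_mem_openConnIn hxu'
  have P2 := pathIn_shift_of_mem_openConnIn hxv'
  -- follow the face-to-face path from the face `z j = c j` to its first passage of level `c j + n`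
  obtain ⟨p, q, hp, hq, hqB, hpq, hP⟩ := (P1.symm.trans P2).exit
    (R := {z : Site 3 | z j < c j + n})
    (by simp only [Set.mem_setOf_eq, Pi.add_apply]; omega)
    (by simp only [Set.mem_setOf_eq, Pi.add_apply, not_lt]; omega)
  simp only [Set.mem_setOf_eq, not_lt] at hp hq
  have hqj : q j = c j + n := by
    have h1 : (zdGraph 3).Adj p q := hω ((openGraph_adj ω p q).1 hpq).1
    have h2 := apply_le_apply_add_one_of_adj h1 j
    omega
  -- this initial segment lies inside the box at `c` as well
  have hP' :
      PathIn (openGraph ω) {z : Site 3 | z - c ∈ (↑(box 3 n) : Set (Site 3))} (u' + c') q := by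
    refine (hP.mono ?_).tail hpq ?_
    · rintro z ⟨hz1, hz2⟩
      exact sub_mem_box_of_level hcj hck hz2 (le_of_lt hz1)
    · exact sub_mem_box_of_level hcj hck hqB hqj.le
  have hloc := mem_openConnIn_shift_of_pathIn hP'
  have hself := mem_openConnIn_shift_of_pathIn (ω := ω) (PathIn.refl hP'.left_mem)
  -- in-box uniqueness at `c`: `x` (spread `2n`) and `u' + c' - c` (spread `n`) are joined
  obtain ⟨⟨u, huj, hxu⟩, ⟨v, hvj, hxv⟩⟩ := hx
  have hxy := hb x (u' + c' - c) ⟨u, v, hxu, hxv, j, le_abs.2 (Or.inr (by omega))⟩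
    ⟨u' + c' - c, q - c, hself, hloc, j,
      le_abs.2 (Or.inr (by simp only [Pi.sub_apply, Pi.add_apply]; omega))⟩
  have Q := pathIn_shift_of_mem_openConnIn hxy
  rw [sub_add_cancel] at Q
  exact (DCT16.reachable_of_pathIn Q).trans (DCT16.reachable_of_pathIn P1).symm

/-- **Gluing of good neighbouring blocks** `a`, `a + eᵢ` of the planar layer: if block `a` is good,
`x` is a crossing vertex of `B(n)` for the configuration shifted by `-blockCentre n a` and `x'` one
for the shift by `-blockCentre n (a + eᵢ)`, then `x + blockCentre n a` and
`x' + blockCentre n (a + eᵢ)` are joined by an open path of `ω` (Grimmett 1999, p.178). -/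
theorem reachable_of_goodBlock_adj {n : ℕ} (hn : 1 ≤ n) {ω : BondConfig (Site 3)}
    (hω : ω ⊆ (zdGraph 3).edgeSet) (a : Site 2) (i : Fin 2) (x x' : Site 3)
    (ha : ω ∈ goodBlock n a)
    (hx : ∀ k : Fin 3,
      (∃ u : Site 3, u k = -(n : ℤ) ∧
        BondConfig.relabel (sym2Equiv (Site.shift (-blockCentre n a))) ω ∈
          openConnIn ↑(box 3 n) x u) ∧
      (∃ v : Site 3, v k = (n : ℤ) ∧
        BondConfig.relabel (sym2Equiv (Site.shift (-blockCentre n a))) ω ∈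
          openConnIn ↑(box 3 n) x v))
    (hx' : ∀ k : Fin 3,
      (∃ u : Site 3, u k = -(n : ℤ) ∧
        BondConfig.relabel (sym2Equiv (Site.shift (-blockCentre n (a + Pi.single i 1)))) ω ∈
          openConnIn ↑(box 3 n) x' u) ∧
      (∃ v : Site 3, v k = (n : ℤ) ∧
        BondConfig.relabel (sym2Equiv (Site.shift (-blockCentre n (a + Pi.single i 1)))) ω ∈
          openConnIn ↑(box 3 n) x' v)) :
    (openGraph ω).Reachable (x + blockCentre n a) (x' + blockCentre n (a + Pi.single i 1)) := by
  have ha' : BondConfig.relabel (sym2Equiv (Site.shift (-blockCentre n a))) ω ∈ goodBox n := ha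
  obtain ⟨-, hb⟩ := ha'
  have hcj : blockCentre n (a + Pi.single i 1) (Fin.castSucc i) =
      blockCentre n a (Fin.castSucc i) + n := by
    rw [blockCentre_add_single_apply, if_pos rfl]
  have hck : ∀ k, k ≠ Fin.castSucc i → blockCentre n (a + Pi.single i 1) k = blockCentre n a k :=
    fun k hk => by rw [blockCentre_add_single_apply, if_neg hk, add_zero]
  exact reachable_of_crossings hn hω hcj hck hb (hx (Fin.castSucc i)) (hx' (Fin.castSucc i))

/-! ## Along coarse open paths -/

/-- **Induction along coarse open paths.**  With one crossing vertex `X b` (local coordinates)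
chosen for every good block `b`, every block `b` of the coarse open cluster of `0` has
`X b + blockCentre n b` joined to `X 0 + blockCentre n 0` by an open path of `ω`: each coarse-open
edge is `{a, a + eᵢ}` with both blocks good (unfolding `coarseCfg`), glued by
`reachable_of_goodBlock_adj`. -/
theorem reachable_crossing_of_coarse {n : ℕ} (hn : 1 ≤ n) {ω : BondConfig (Site 3)}
    (hω : ω ⊆ (zdGraph 3).edgeSet) (X : Site 2 → Site 3)
    (hX : ∀ b : Site 2, ω ∈ goodBlock n b → ∀ k : Fin 3,
      (∃ u : Site 3, u k = -(n : ℤ) ∧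
        BondConfig.relabel (sym2Equiv (Site.shift (-blockCentre n b))) ω ∈
          openConnIn ↑(box 3 n) (X b) u) ∧
      (∃ v : Site 3, v k = (n : ℤ) ∧
        BondConfig.relabel (sym2Equiv (Site.shift (-blockCentre n b))) ω ∈
          openConnIn ↑(box 3 n) (X b) v))
    {b : Site 2} (h : (openGraph (coarseCfg n ω)).Reachable 0 b) :
    (openGraph ω).Reachable (X 0 + blockCentre n 0) (X b + blockCentre n b) := by
  rw [SimpleGraph.reachable_iff_reflTransGen] at h
  induction h with
  | refl => exact SimpleGraph.Reachable.refl _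
  | @tail b₁ b₂ _ hadj ih =>
    obtain ⟨hmem, -⟩ := (openGraph_adj _ b₁ b₂).1 hadj
    simp only [coarseCfg, Set.mem_setOf_eq] at hmem
    obtain ⟨a, i, he, hga, hga'⟩ := hmem
    have key := reachable_of_goodBlock_adj hn hω a i (X a) (X (a + Pi.single i 1)) hga (hX a hga)
      (hX _ hga')
    rw [Sym2.eq_iff] at he
    rcases he with ⟨rfl, rfl⟩ | ⟨rfl, rfl⟩
    · exact ih.trans key
    · exact ih.trans key.symm

/-! ## The registered stub -/

/-- **Registered stub `stub_coarseGlue` of crux stmt-CriticalPhenomena-0857 (line `registered`)**: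
for `n ≥ 1` and a lattice configuration `ω ⊆ E(ℤ³)`, if the cluster of `0` in the coarse good-edge
configuration `coarseCfg n ω` on `ℤ²` is infinite, then some vertex `x ∈ B(n)` has an infinite open
cluster in `ω` (Grimmett 1999, §7.4 p.178, Fig. 7.13: an infinite path of good blocks carries an
infinite open path; here `x` is the crossing vertex of the good block `0`, and the crossing vertices
of the blocks of the coarse cluster, all joined to `x`, form an unbounded set since each lies in its
own block). -/
theorem stub_coarseGlue :
    ∀ n : ℕ, 1 ≤ n → ∀ ω : BondConfig (Site 3), ω ⊆ (zdGraph 3).edgeSet →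
      coarseCfg n ω ∈ percolatesAt (0 : Site 2) → ∃ x ∈ box 3 n, ω ∈ percolatesAt x := by
  intro n hn ω hω hperc
  -- one crossing vertex per good block (local coordinates), `0` for the other blocks
  have hXex : ∀ b : Site 2, ∃ x : Site 3, x ∈ box 3 n ∧ (ω ∈ goodBlock n b → ∀ k : Fin 3,
      (∃ u : Site 3, u k = -(n : ℤ) ∧
        BondConfig.relabel (sym2Equiv (Site.shift (-blockCentre n b))) ω ∈
          openConnIn ↑(box 3 n) x u) ∧
      (∃ v : Site 3, v k = (n : ℤ) ∧
        BondConfig.relabel (sym2Equiv (Site.shift (-blockCentre n b))) ω ∈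
          openConnIn ↑(box 3 n) x v)) := by
    intro b
    by_cases hb : ω ∈ goodBlock n b
    · have hb' : BondConfig.relabel (sym2Equiv (Site.shift (-blockCentre n b))) ω ∈ goodBox n := hb
      obtain ⟨⟨x, hx⟩, -⟩ := hb'
      obtain ⟨⟨u, -, hxS, -, -⟩, -⟩ := hx 0
      exact ⟨x, hxS, fun _ => hx⟩
    · exact ⟨0, by simp, fun h => absurd h hb⟩
  choose X hXbox hX using hXex
  refine ⟨X 0, hXbox 0, ?_⟩
  -- adapted from `exists_infinite_openCluster_of_coarse` (SlabCriticalityInputs.lean)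
  have hinf : (openCluster (coarseCfg n ω) (0 : Site 2)).Infinite := hperc
  by_contra hcon
  have hcon' : ¬ (openCluster ω (X 0)).Infinite := hcon
  have hfin : (openCluster ω (X 0)).Finite := Set.not_infinite.1 hcon'
  obtain ⟨M, hM⟩ : ∃ M : ℕ, ∀ v ∈ openCluster ω (X 0), |v 0| ≤ M ∧ |v 1| ≤ M := by
    obtain ⟨B, hB⟩ := (hfin.image fun v => max |v 0| |v 1|).bddAbove
    refine ⟨B.toNat, fun v hv => ?_⟩
    have h' : max |v 0| |v 1| ≤ (B.toNat : ℤ) :=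
      (hB (Set.mem_image_of_mem _ hv)).trans (Int.self_le_toNat B)
    exact ⟨(le_max_left _ _).trans h', (le_max_right _ _).trans h'⟩
  obtain ⟨y, hy, hyF⟩ := hinf.exists_notMem_finset (box 2 (M + n))
  have hreach := reachable_crossing_of_coarse hn hω X hX hy
  rw [blockCentre_zero, add_zero] at hreach
  obtain ⟨h0, h1⟩ := hM _ hreach
  have e0 : (X y + blockCentre n y) 0 = X y 0 + n * y 0 := by simp [blockCentre]
  have e1 : (X y + blockCentre n y) 1 = X y 1 + n * y 1 := by simp [blockCentre]
  rw [e0, abs_le] at h0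
  rw [e1, abs_le] at h1
  have hXy := mem_box.1 (hXbox y)
  obtain ⟨hx0, hx0'⟩ := hXy 0
  obtain ⟨hx1, hx1'⟩ := hXy 1
  have key : ∀ i, (y i).natAbs ≤ ((n : ℤ) * y i).natAbs := fun i => by
    rw [Int.natAbs_mul, Int.natAbs_natCast]; exact Nat.le_mul_of_pos_left _ hn
  have k0 := key 0
  have k1 := key 1
  simp only [mem_box, not_forall, not_and_or, not_le] at hyF
  obtain ⟨j, hj⟩ := hyF
  fin_cases j <;> simp at hj <;> omega

end Summit.CriticalPhenomena.PercolationContinuityZ3.Theorems.RenormaliseFromLinearLRO
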